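import Summits.HodgeConjecture.HodgeConjecture.Theorems.HodgeLocusCensusUnitRigidity

/-!
# Hodge-locus census, V3-XT N = 1 — UNIT RIGIDITY AT THE PRIME 2: the unit law (U2) of THEOREM-sketch DI-gen(2) as THEOREMS (every tower of the Hurwitz order)

certified instances and evidence bearing on the general Hodge conjecture; no claim.

Setting (records `DERIVATION-DI2-B.md` §0 (U2), §3 of the pub-hlocus cell; seat pub-hlocus-abs-2 gen 39, engine B).
`HodgeLocusCensusUnitRigidity` proves, for every DEFINITE `(a,b)_ℚ` and every set `O` with integral reduced norms, that a unit
`u ≡ 1 (mod M·O)`, `|M| ≥ 3`, equals `1`, and records that `|M| = 2` is genuinely excluded (`u = -1`).  The census at the last prime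
`ℓ = 2` (DI-gen(2): `B_{2,∞} = (-1,-1)_ℚ`, `O` the HURWITZ order, towers `T_{a,m} = ℤ[ω_a] + 2^m O`, `ω_a = (1 + s_a)/2`,
`s_a = x₁ i + x₂ j + x₃ k` with all `x_t` odd, `s_a² = D' ≡ 5 (mod 8)`) needs exactly the modulus `2`.  Proved here:
* `eq_or_eq_neg_of_sub_eq_two_smul` — **SIGN RIGIDITY** (every definite `(a,b)_ℚ`): `nrd u = nrd u' = 1`, `u - u' = 2β`,
  `nrd β ∈ ℤ` ⇒ `u = ±u'` (parallelogram law: `nrd(u-u') + nrd(u+u') = 4`); corollaries: the KERNEL of reduction modulo `2O` on the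
  units of any definite order is `{±1}` (`unit_eq_one_or_neg_one_of_sub_one_eq_two_smul`), injectivity up to sign;
* `hurwitz` (all coordinates in `ℤ`, or all in `ℤ + ½`) with integral norms/traces, closure under `+` and `ℤ•`, `1 ∈ O`,
  `half_mem_hurwitz` (`(1 + x₁ i + x₂ j + x₃ k)/2 ∈ O` for odd `x_t`: this is `ω_a`, and for `x_t = ±1` a unit of order `6`);
* `tower_add`, `tower_zsmul`, `tower_one_mem`, `tower_sq_mem` — a tower is closed under `+`, `ℤ•` and contains `u² = trd(u)·u - 1`
  for every norm-one `u ∈ T` of integral trace (Cayley–Hamilton), so NO multiplicative closure of `O` is needed anywhere;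
* (R) `tower_residue_classes`: modulo `2O`, `ℤ + ℤc + 2^m O` (`m ≥ 1`, `c ∈ O`) has only the classes `0, 1, c, 1 + c`;
  `norm_one_not_in_zero_class`;
* (Sq) `sq_class_of_gen_class` / `sq_class_of_one_add_gen_class`: for a norm-one `u`, `u ≡ ω ⇒ u² ≡ 1 + ω` and `u ≡ 1 + ω ⇒ u² ≡ ω`
  (`omega_sq`: `ω_a² = ω_a - N·1`, `N = 1 + Σ (n_t² + n_t)` odd, `N_odd`);
* (L1) `sign_mod_four`, `levelOne_unit_mem_tower`, `levelOne_unit_hexagon`, `levelOne_six_units`: for EVERY odd `(x₁,x₂,x₃)` the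
  Hurwitz unit `u = (1 + ε₁ i + ε₂ j + ε₃ k)/2`, `ε_t ≡ x_t (mod 4)`, lies in `T_{a,1}` with its inverse `1 - u`; `nrd u = 1`, `u³ = -1`,
  `u² ≠ 1`, `u ≠ 1` (order exactly `6`);  and `unit_law_U2` assembling (R), sign rigidity, `tower_sq_mem`, (Sq) per tower and level.
CONSEQUENCE ((U2) of DI-gen(2), for every tower `a` and every `m ≥ 1`): the units of `T_{a,m}` lie in the classes `1, ω_a, 1 + ω_a`,
at most two per class, exactly `±1` in the class of `1`, and the classes `ω_a`, `1 + ω_a` are simultaneously occupied or empty: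
`|U_{a,m}| ∈ {2, 6}`, never `4`, and `|U_{a,1}| = 6`.  So in the pairwise law (P) `v₂(j(E_a) - j(E_b)) = ½ Σ_{n ≤ depth} |U_{a,n-1}|`
the values are `12, 15, 16 or 18, …`, and `13, 14` never occur — as the kit census of gen 39 observes on every pair.  Only the two
cardinality sentences are not spelled out as `Finset` statements; everything they rest on is proved.  Nothing here is a statement
about algebraic cycles.
-/


set_option linter.dupNamespace false

namespace Summit.HodgeConjecture.HodgeConjecture.HodgeLocus.Census.UnitRigidityTwo

open Summit.HodgeConjecture.HodgeConjecture.HodgeLocus.Census.UnitRigidity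

/-! ## Sign rigidity at modulus 2 (every definite `(a,b)_ℚ`) -/

/-- Parallelogram law of the quadratic form `nrd`. -/
theorem nrd_add_add_nrd_sub (a b : ℚ) (x y : Q4) :
    nrd a b (x + y) + nrd a b (x - y) = 2 * nrd a b x + 2 * nrd a b y := by
  simp [nrd]; ring
/-- **SIGN RIGIDITY**: in a definite `(a,b)_ℚ`, if `nrd u = nrd u' = 1` and `u - u' = 2β` with `nrd β = k ∈ ℤ`, then `u = u'` or
`u = -u'`.  (`4k = nrd(u-u') ≤ nrd(u-u') + nrd(u+u') = 4`, so `k ∈ {0,1}`; `k = 1` gives `nrd(u+u') = 0`.) -/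
theorem eq_or_eq_neg_of_sub_eq_two_smul {a b : ℚ} (ha : a < 0) (hb : b < 0) {u u' β : Q4}
    (hu : nrd a b u = 1) (hu' : nrd a b u' = 1) {k : ℤ} (hk : nrd a b β = k) (h : u - u' = (2 : ℚ) • β) :
    u = u' ∨ u = -u' := by
  have hpar := nrd_add_add_nrd_sub a b u u'
  rw [hu, hu'] at hpar
  have hsub : nrd a b (u - u') = 4 * k := by rw [h, nrd_smul, hk]; ring
  have h1 : 0 ≤ nrd a b (u + u') := nrd_nonneg ha hb _
  have h2 : (0 : ℚ) ≤ k := hk ▸ nrd_nonneg ha hb β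
  have hk1 : (k : ℚ) ≤ 1 := by linarith
  have hk' : k = 0 ∨ k = 1 := by
    have a1 : k ≤ 1 := by exact_mod_cast hk1
    have a2 : 0 ≤ k := by exact_mod_cast h2
    omega
  rcases hk' with rfl | rfl
  · left
    have h0 : nrd a b (u - u') = 0 := by rw [hsub]; simp
    exact sub_eq_zero.mp ((nrd_eq_zero_iff ha hb _).mp h0)
  · right
    have h4 : nrd a b (u - u') = 4 := by rw [hsub]; simp
    have h0 : nrd a b (u + u') = 0 := by linarith
    exact eq_neg_of_add_eq_zero_left ((nrd_eq_zero_iff ha hb _).mp h0)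
/-- The KERNEL of reduction modulo `2O` on the units of a definite order `O` (integral norms) is `{1, -1}`: a unit `u` (right
inverse `v ∈ O`) with `u - 1 = 2β`, `β ∈ O`, is `1` or `-1`.  This is the modulus `|M| = 2` complement of
`UnitRigidity.unit_eq_one_of_sub_one_eq_smul` (`|M| ≥ 3 ⇒ u = 1`). -/
theorem unit_eq_one_or_neg_one_of_sub_one_eq_two_smul {a b : ℚ} (ha : a < 0) (hb : b < 0) {O : Set Q4}
    (hO : ∀ x ∈ O, ∃ n : ℤ, nrd a b x = n) {u v β : Q4} (hu : u ∈ O) (hv : v ∈ O) (hβ : β ∈ O)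
    (huv : qmul a b u v = one) (h : u - one = (2 : ℚ) • β) : u = one ∨ u = -one := by
  obtain ⟨k, hk⟩ := hO β hβ
  exact eq_or_eq_neg_of_sub_eq_two_smul ha hb (nrd_eq_one_of_unit ha hb hO hu hv huv) (nrd_one a b) hk h
/-- Reduction modulo `2O` is INJECTIVE UP TO SIGN on the units of a definite order: units `u, u'` of `O` with `u - u' ∈ 2O` satisfy
`u = ±u'`.  For DI-gen(2): `U_{a,m} → (O/2O)^×` has kernel `{±1}` for every tower and every `m ≥ 1`. -/
theorem unit_eq_or_eq_neg_of_sub_eq_two_smul {a b : ℚ} (ha : a < 0) (hb : b < 0) {O : Set Q4}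
    (hO : ∀ x ∈ O, ∃ n : ℤ, nrd a b x = n) {u v u' v' β : Q4} (hu : u ∈ O) (hv : v ∈ O) (hu' : u' ∈ O) (hv' : v' ∈ O)
    (hβ : β ∈ O) (huv : qmul a b u v = one) (hu'v' : qmul a b u' v' = one) (h : u - u' = (2 : ℚ) • β) :
    u = u' ∨ u = -u' := by
  obtain ⟨k, hk⟩ := hO β hβ
  exact eq_or_eq_neg_of_sub_eq_two_smul ha hb (nrd_eq_one_of_unit ha hb hO hu hv huv)
    (nrd_eq_one_of_unit ha hb hO hu' hv' hu'v') hk h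

/-! ## Towers are closed under `+`, `ℤ•`, and `u ↦ u²` (Cayley–Hamilton) -/

/-- A tower is closed under addition (given `O` is). -/
theorem tower_add {O : Set Q4} (hOadd : ∀ x ∈ O, ∀ y ∈ O, x + y ∈ O) {c : Q4} {lam : ℤ} {x y : Q4}
    (hx : x ∈ tower O c lam) (hy : y ∈ tower O c lam) : x + y ∈ tower O c lam := by
  obtain ⟨p, q, β, hβ, rfl⟩ := hx
  obtain ⟨p', q', β', hβ', rfl⟩ := hy
  refine ⟨p + p', q + q', β + β', hOadd _ hβ _ hβ', ?_⟩
  push_cast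
  simp only [add_smul, smul_add]
  abel
/-- A tower is closed under integer multiples (given `O` is). -/
theorem tower_zsmul {O : Set Q4} (hOsmul : ∀ (n : ℤ), ∀ x ∈ O, (n : ℚ) • x ∈ O) {c : Q4} {lam : ℤ} (n : ℤ) {x : Q4}
    (hx : x ∈ tower O c lam) : (n : ℚ) • x ∈ tower O c lam := by
  obtain ⟨p, q, β, hβ, rfl⟩ := hx
  refine ⟨n * p, n * q, (n : ℚ) • β, hOsmul n _ hβ, ?_⟩
  push_cast
  simp only [smul_add, smul_smul, mul_comm (lam : ℚ) (n : ℚ)]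
/-- `1 ∈ T` (needs only `0 ∈ O`). -/
theorem tower_one_mem {O : Set Q4} (h0 : (0 : Q4) ∈ O) (c : Q4) (lam : ℤ) : one ∈ tower O c lam :=
  ⟨1, 0, 0, h0, by simp⟩
/-- **SQUARES STAY IN THE TOWER**: if `u ∈ T` has `nrd u = 1` and integral trace `trd u = t`, then `u² = t·u - 1 ∈ T`
(Cayley–Hamilton `UnitRigidity.qmul_self`); no multiplicative closure of `O` is used.  So `u ↦ u²` maps `U_{a,m}` to itself. -/
theorem tower_sq_mem {a b : ℚ} {O : Set Q4} (hOadd : ∀ x ∈ O, ∀ y ∈ O, x + y ∈ O)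
    (hOsmul : ∀ (n : ℤ), ∀ x ∈ O, (n : ℚ) • x ∈ O) (h0 : (0 : Q4) ∈ O) {c : Q4} {lam : ℤ} {u : Q4}
    (hu : u ∈ tower O c lam) (hn : nrd a b u = 1) {t : ℤ} (ht : trd u = t) :
    qmul a b u u ∈ tower O c lam := by
  rw [qmul_self, hn, ht, one_smul]
  have h1 : (t : ℚ) • u ∈ tower O c lam := tower_zsmul hOsmul t hu
  have h2 : ((-1 : ℤ) : ℚ) • one ∈ tower O c lam := tower_zsmul hOsmul (-1) (tower_one_mem h0 c lam)
  have := tower_add hOadd h1 h2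
  simpa [sub_eq_add_neg] using this

/-! ## The Hurwitz order in coordinates -/

/-- The HURWITZ order `O ⊂ (-1,-1)_ℚ`: coordinate vectors w.r.t. `1, i, j, k` with all four coordinates in `ℤ`, or all four in
`ℤ + ½`.  (It is the maximal order `ℤ⟨1, i, j, (1+i+j+k)/2⟩ = End Ē` for the supersingular curve over `𝔽̄₂`.) -/
def hurwitz : Set Q4 :=
  {x | ∃ n : Fin 4 → ℤ, (x = fun t => (n t : ℚ)) ∨ (x = fun t => (n t : ℚ) + 1 / 2)}
/-- Reduced norms on the Hurwitz order are integers (`Σ (n_t + ½)² = Σ (n_t² + n_t) + 1`). -/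
theorem hurwitz_nrd : ∀ x ∈ hurwitz, ∃ n : ℤ, nrd (-1) (-1) x = n := by
  rintro x ⟨n, h | h⟩ <;> subst h
  · exact ⟨n 0 ^ 2 + n 1 ^ 2 + n 2 ^ 2 + n 3 ^ 2, by simp [nrd]⟩
  · exact ⟨n 0 ^ 2 + n 0 + n 1 ^ 2 + n 1 + n 2 ^ 2 + n 2 + n 3 ^ 2 + n 3 + 1, by simp [nrd]; ring⟩
/-- Reduced traces on the Hurwitz order are integers. -/
theorem hurwitz_trd : ∀ x ∈ hurwitz, ∃ t : ℤ, trd x = t := by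
  rintro x ⟨n, h | h⟩ <;> subst h
  · exact ⟨2 * n 0, by simp [trd]⟩
  · exact ⟨2 * n 0 + 1, by simp [trd]; ring⟩
/-- The Hurwitz order is closed under addition. -/
theorem hurwitz_add : ∀ x ∈ hurwitz, ∀ y ∈ hurwitz, x + y ∈ hurwitz := by
  rintro x ⟨n, h | h⟩ y ⟨n', h' | h'⟩ <;> subst h <;> subst h'
  · exact ⟨fun t => n t + n' t, Or.inl (by funext t; push_cast; simp)⟩
  · exact ⟨fun t => n t + n' t, Or.inr (by funext t; push_cast; simp only [Pi.add_apply]; ring)⟩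
  · exact ⟨fun t => n t + n' t, Or.inr (by funext t; push_cast; simp only [Pi.add_apply]; ring)⟩
  · exact ⟨fun t => n t + n' t + 1, Or.inl (by funext t; push_cast; simp only [Pi.add_apply]; ring)⟩
/-- The Hurwitz order is closed under integer multiples (an even multiple of a half-integral vector is integral, an odd one
half-integral). -/
theorem hurwitz_zsmul : ∀ (m : ℤ), ∀ x ∈ hurwitz, (m : ℚ) • x ∈ hurwitz := by
  rintro m x ⟨n, h | h⟩ <;> subst h
  · exact ⟨fun t => m * n t, Or.inl (by funext t; push_cast; simp)⟩
  · obtain ⟨m', hm | hm⟩ := Int.even_or_odd' m <;> subst hm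
    · exact ⟨fun t => 2 * m' * n t + m', Or.inl (by funext t; push_cast; simp only [Pi.smul_apply, smul_eq_mul]; ring)⟩
    · exact ⟨fun t => (2 * m' + 1) * n t + m', Or.inr (by funext t; push_cast; simp only [Pi.smul_apply, smul_eq_mul]; ring)⟩
/-- `0 ∈ O`. -/
theorem zero_mem_hurwitz : (0 : Q4) ∈ hurwitz := ⟨fun _ => 0, Or.inl (by funext t; simp)⟩
/-- `1 ∈ O`. -/
theorem one_mem_hurwitz : one ∈ hurwitz := by
  refine ⟨![1, 0, 0, 0], Or.inl ?_⟩
  funext t; fin_cases t <;> simp [one]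
/-- `(1 + y₁ i + y₂ j + y₃ k)/2` in coordinates. For odd integers `y_t` it lies in the Hurwitz order: with `y = x` (the root
`s_a = x₁ i + x₂ j + x₃ k`, `s_a² = -(x₁² + x₂² + x₃²) = D'`) it is `ω_a = (1 + s_a)/2`; with `y_t = ε_t = ±1` it is a Hurwitz UNIT. -/
def half (y₁ y₂ y₃ : ℚ) : Q4 := ![1 / 2, y₁ / 2, y₂ / 2, y₃ / 2]
/-- Real coordinate of `half`. -/
@[simp] lemma half_apply_zero (y₁ y₂ y₃ : ℚ) : half y₁ y₂ y₃ 0 = 1 / 2 := rfl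
/-- `i`-coordinate of `half`. -/
@[simp] lemma half_apply_one (y₁ y₂ y₃ : ℚ) : half y₁ y₂ y₃ 1 = y₁ / 2 := rfl
/-- `j`-coordinate of `half`. -/
@[simp] lemma half_apply_two (y₁ y₂ y₃ : ℚ) : half y₁ y₂ y₃ 2 = y₂ / 2 := rfl
/-- `k`-coordinate of `half`. -/
@[simp] lemma half_apply_three (y₁ y₂ y₃ : ℚ) : half y₁ y₂ y₃ 3 = y₃ / 2 := rfl
/-- `(1 + x₁ i + x₂ j + x₃ k)/2 ∈ O` for odd `x_t = 2n_t + 1`. -/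
theorem half_mem_hurwitz (n₁ n₂ n₃ : ℤ) :
    half (2 * n₁ + 1) (2 * n₂ + 1) (2 * n₃ + 1) ∈ hurwitz := by
  refine ⟨![0, n₁, n₂, n₃], Or.inr ?_⟩
  funext t; fin_cases t <;> simp <;> ring
/-- The constant `N = (1 - D')/4 = 1 + Σ (n_t² + n_t)` of the minimal polynomial `X² - X + N` of `ω_a`, for `x_t = 2n_t + 1`. -/
def Nn (n₁ n₂ n₃ : ℤ) : ℤ := 1 + (n₁ ^ 2 + n₁) + (n₂ ^ 2 + n₂) + (n₃ ^ 2 + n₃)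
/-- `N` is odd (equivalently `D' = 1 - 4N ≡ 5 (mod 8)`): `n² + n` is even. -/
theorem N_odd (n₁ n₂ n₃ : ℤ) : ∃ k : ℤ, Nn n₁ n₂ n₃ = 2 * k + 1 := by
  obtain ⟨a, ha⟩ := Int.even_mul_succ_self n₁
  obtain ⟨b, hb⟩ := Int.even_mul_succ_self n₂
  obtain ⟨c, hc⟩ := Int.even_mul_succ_self n₃
  exact ⟨a + b + c, by unfold Nn; nlinarith [ha, hb, hc]⟩
/-- `ω_a² = ω_a - N·1` in `(-1,-1)_ℚ` (`ω_a` is a root of `X² - X + N`). -/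
theorem omega_sq (n₁ n₂ n₃ : ℤ) :
    qmul (-1) (-1) (half (2 * n₁ + 1) (2 * n₂ + 1) (2 * n₃ + 1)) (half (2 * n₁ + 1) (2 * n₂ + 1) (2 * n₃ + 1))
      = half (2 * n₁ + 1) (2 * n₂ + 1) (2 * n₃ + 1) - (Nn n₁ n₂ n₃ : ℚ) • one := by
  ext t; fin_cases t <;> simp [Nn] <;> ring
/-- `nrd ω_a = N` and `trd ω_a = 1`. -/
theorem omega_nrd_trd (n₁ n₂ n₃ : ℤ) :
    nrd (-1) (-1) (half (2 * n₁ + 1) (2 * n₂ + 1) (2 * n₃ + 1)) = Nn n₁ n₂ n₃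
      ∧ trd (half (2 * n₁ + 1) (2 * n₂ + 1) (2 * n₃ + 1)) = 1 := by
  constructor
  · simp [nrd, Nn]; ring
  · simp [trd]

/-! ## (R) residue classes of a tower modulo `2O` -/

/-- **(R) RESIDUE CLASSES**: an element of `T = ℤ·1 + ℤ·c + 2^m·O` (`m ≥ 1`, `O` the Hurwitz order, `c ∈ O`) is congruent modulo
`2O` to `p̄·1 + q̄·c` with `p̄, q̄ ∈ {0, 1}` — the four classes `0, 1, c, 1 + c` (`T/2O ⊆ 𝔽₂[c̄]`; for `c = ω_a` this is `𝔽₄`). -/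
theorem tower_residue_classes {c : Q4} (hc : c ∈ hurwitz) {m : ℕ} (hm : 1 ≤ m) {x : Q4}
    (hx : x ∈ tower hurwitz c ((2 : ℤ) ^ m)) :
    ∃ (pb qb : ℤ) (β : Q4), (pb = 0 ∨ pb = 1) ∧ (qb = 0 ∨ qb = 1) ∧ β ∈ hurwitz ∧
      x - ((pb : ℚ) • one + (qb : ℚ) • c) = (2 : ℚ) • β := by
  obtain ⟨p, q, β, hβ, rfl⟩ := hx
  obtain ⟨m', rfl⟩ : ∃ m', m = m' + 1 := ⟨m - 1, by omega⟩
  refine ⟨p % 2, q % 2, ((p / 2 : ℤ) : ℚ) • one + ((q / 2 : ℤ) : ℚ) • c + (((2 : ℤ) ^ m' : ℤ) : ℚ) • β,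
    Int.emod_two_eq_zero_or_one p, Int.emod_two_eq_zero_or_one q, ?_, ?_⟩
  · exact hurwitz_add _ (hurwitz_add _ (hurwitz_zsmul _ _ one_mem_hurwitz) _ (hurwitz_zsmul _ _ hc)) _ (hurwitz_zsmul _ _ hβ)
  · have hp' : p = 2 * (p / 2) + p % 2 := by omega
    have hq' : q = 2 * (q / 2) + q % 2 := by omega
    have hp : (p : ℚ) = 2 * ((p / 2 : ℤ) : ℚ) + ((p % 2 : ℤ) : ℚ) := by exact_mod_cast hp'
    have hq : (q : ℚ) = 2 * ((q / 2 : ℤ) : ℚ) + ((q % 2 : ℤ) : ℚ) := by exact_mod_cast hq'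
    ext t
    simp only [Pi.add_apply, Pi.sub_apply, Pi.smul_apply, smul_eq_mul]
    push_cast
    linear_combination (one t) * hp + (c t) * hq
/-- A vector of reduced norm `1` is NOT in the class `0`: `x = 2β`, `β ∈ O` gives `nrd x = 4·nrd β ≠ 1`. So the units of a tower
lie in the classes `1, c, 1 + c` only. -/
theorem norm_one_not_in_zero_class {x β : Q4} (hβ : β ∈ hurwitz) (hx : nrd (-1) (-1) x = 1) : x ≠ (2 : ℚ) • β := by
  intro h
  obtain ⟨k, hk⟩ := hurwitz_nrd β hβ
  have : (1 : ℚ) = 4 * k := by rw [← hx, h, nrd_smul, hk]; ring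
  have h4 : (4 : ℤ) * k = 1 := by exact_mod_cast this.symm
  omega

/-! ## (Sq) squaring exchanges the classes `ω` and `1 + ω` (`N` odd) -/

/-- **(Sq)** If `ω² = ω - N·1` with `N = 2k+1` odd, `u ∈ O` has `nrd u = 1`, integral trace, and `u ≡ ω (mod 2O)` (`u - ω = 2β`),
then `u² ≡ 1 + ω (mod 2O)`.  (`u² = trd(u)·u - 1`, `trd u = trd ω + 2 trd β = 1 + 2 trd β`.) -/
theorem sq_class_of_gen_class {ω u β : Q4} {N k : ℤ} (_hN : N = 2 * k + 1)
    (_hω : qmul (-1) (-1) ω ω = ω - (N : ℚ) • one) (hωt : trd ω = 1)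
    (hu : u ∈ hurwitz) (hβ : β ∈ hurwitz) (hn : nrd (-1) (-1) u = 1) (h : u - ω = (2 : ℚ) • β) :
    ∃ γ ∈ hurwitz, qmul (-1) (-1) u u - (one + ω) = (2 : ℚ) • γ := by
  obtain ⟨tb, htb⟩ := hurwitz_trd β hβ
  have hut : trd u = 1 + 2 * tb := by
    have : u = ω + (2 : ℚ) • β := by rw [← h]; abel
    rw [this]; simp only [trd, Pi.add_apply, Pi.smul_apply, smul_eq_mul] at *; linarith
  refine ⟨β + (tb : ℚ) • u + ((-1 : ℤ) : ℚ) • one, ?_, ?_⟩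
  · exact hurwitz_add _ (hurwitz_add _ hβ _ (hurwitz_zsmul tb _ hu)) _ (hurwitz_zsmul (-1) _ one_mem_hurwitz)
  · rw [qmul_self, hn, hut, one_smul]
    have : u = ω + (2 : ℚ) • β := by rw [← h]; abel
    ext t
    simp only [Pi.add_apply, Pi.sub_apply, Pi.smul_apply, smul_eq_mul]
    push_cast
    have ht := congrFun this t
    simp only [Pi.add_apply, Pi.smul_apply, smul_eq_mul] at ht
    linear_combination (1 : ℚ) * ht
/-- **(Sq), converse direction**: a norm-one `u ≡ 1 + ω (mod 2O)` has `u² ≡ ω (mod 2O)` (here `trd u = 3 + 2 trd β`). Hence the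
classes `ω` and `1 + ω` of `U_{a,m}` are simultaneously occupied or empty, which excludes `|U_{a,m}| = 4`. -/
theorem sq_class_of_one_add_gen_class {ω u β : Q4} {N k : ℤ} (_hN : N = 2 * k + 1)
    (_hω : qmul (-1) (-1) ω ω = ω - (N : ℚ) • one) (hωt : trd ω = 1)
    (hu : u ∈ hurwitz) (hβ : β ∈ hurwitz) (hωO : ω ∈ hurwitz) (hn : nrd (-1) (-1) u = 1)
    (h : u - (one + ω) = (2 : ℚ) • β) :
    ∃ γ ∈ hurwitz, qmul (-1) (-1) u u - ω = (2 : ℚ) • γ := by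
  obtain ⟨tb, htb⟩ := hurwitz_trd β hβ
  have hut : trd u = 3 + 2 * tb := by
    have : u = one + ω + (2 : ℚ) • β := by rw [← h]; abel
    rw [this]; simp only [trd, Pi.add_apply, Pi.smul_apply, smul_eq_mul, one_apply_zero] at *; linarith
  refine ⟨one + ω + ((3 : ℤ) : ℚ) • β + (tb : ℚ) • u, ?_, ?_⟩
  · exact hurwitz_add _ (hurwitz_add _ (hurwitz_add _ one_mem_hurwitz _ hωO) _ (hurwitz_zsmul 3 _ hβ)) _ (hurwitz_zsmul tb _ hu)
  · rw [qmul_self, hn, hut, one_smul]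
    have : u = one + ω + (2 : ℚ) • β := by rw [← h]; abel
    ext t
    simp only [Pi.add_apply, Pi.sub_apply, Pi.smul_apply, smul_eq_mul]
    push_cast
    have ht := congrFun this t
    simp only [Pi.add_apply, Pi.smul_apply, smul_eq_mul] at ht
    linear_combination (3 : ℚ) * ht

/-! ## (L1) the level-one hexagon: `|U_{a,1}| = 6` for every tower -/

/-- Every odd integer is `≡ 1` or `≡ -1 (mod 4)`: a sign `ε` with `x - ε ∈ 4ℤ`. -/
theorem sign_mod_four (n : ℤ) : ∃ ε d : ℤ, (ε = 1 ∨ ε = -1) ∧ 2 * n + 1 - ε = 4 * d := by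
  obtain ⟨k, hk | hk⟩ := Int.even_or_odd' n <;> subst hk
  · exact ⟨1, k, Or.inl rfl, by ring⟩
  · exact ⟨-1, k + 1, Or.inr rfl, by ring⟩
/-- **(L1) THE LEVEL-ONE UNIT**: for odd `x_t = 2n_t + 1` and signs `ε_t` with `x_t - ε_t = 4d_t`, the element
`u = (1 + ε₁ i + ε₂ j + ε₃ k)/2` and its conjugate `1 - u` both lie in `T_{a,1} = ℤ·1 + ℤ·ω_a + 2·O`
(`u = ω_a - 2·(d₁ i + d₂ j + d₃ k)`). -/
theorem levelOne_unit_mem_tower (n₁ n₂ n₃ ε₁ ε₂ ε₃ d₁ d₂ d₃ : ℤ)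
    (h₁ : 2 * n₁ + 1 - ε₁ = 4 * d₁) (h₂ : 2 * n₂ + 1 - ε₂ = 4 * d₂) (h₃ : 2 * n₃ + 1 - ε₃ = 4 * d₃) :
    half ε₁ ε₂ ε₃ ∈ tower hurwitz (half (2 * n₁ + 1) (2 * n₂ + 1) (2 * n₃ + 1)) 2
      ∧ one - half ε₁ ε₂ ε₃ ∈ tower hurwitz (half (2 * n₁ + 1) (2 * n₂ + 1) (2 * n₃ + 1)) 2 := by
  have e₁ : (ε₁ : ℚ) = 2 * n₁ + 1 - 4 * d₁ := by
    have := congrArg (Int.cast : ℤ → ℚ) h₁; push_cast at this; linarith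
  have e₂ : (ε₂ : ℚ) = 2 * n₂ + 1 - 4 * d₂ := by
    have := congrArg (Int.cast : ℤ → ℚ) h₂; push_cast at this; linarith
  have e₃ : (ε₃ : ℚ) = 2 * n₃ + 1 - 4 * d₃ := by
    have := congrArg (Int.cast : ℤ → ℚ) h₃; push_cast at this; linarith
  constructor
  · refine ⟨0, 1, ![0, -(d₁ : ℚ), -(d₂ : ℚ), -(d₃ : ℚ)], ⟨![0, -d₁, -d₂, -d₃], Or.inl ?_⟩, ?_⟩
    · funext t; fin_cases t <;> simp
    · ext t; fin_cases t <;> simp [e₁, e₂, e₃] <;> ring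
  · refine ⟨1, -1, ![0, (d₁ : ℚ), (d₂ : ℚ), (d₃ : ℚ)], ⟨![0, d₁, d₂, d₃], Or.inl ?_⟩, ?_⟩
    · funext t; fin_cases t <;> simp
    · ext t; fin_cases t <;> simp [e₁, e₂, e₃] <;> ring
/-- **(L1) THE HEXAGON**: for signs `ε_t = ±1`, `u = (1 + ε₁ i + ε₂ j + ε₃ k)/2` is a Hurwitz unit of reduced norm `1` with inverse
`1 - u = ū` (both products), `u³ = -1`, `u² ≠ 1`, `u ≠ 1` — so `u` has order exactly `6` and, by `levelOne_unit_mem_tower`,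
`{±1, ±u, ±u²} ⊆ U_{a,1}`: with (R), sign rigidity and (Sq), `|U_{a,1}| = 6` for every tower of DI-gen(2). -/
theorem levelOne_unit_hexagon (ε₁ ε₂ ε₃ : ℤ) (h₁ : ε₁ = 1 ∨ ε₁ = -1) (h₂ : ε₂ = 1 ∨ ε₂ = -1) (h₃ : ε₃ = 1 ∨ ε₃ = -1) :
    half ε₁ ε₂ ε₃ ∈ hurwitz ∧ nrd (-1) (-1) (half ε₁ ε₂ ε₃) = 1
      ∧ qmul (-1) (-1) (half ε₁ ε₂ ε₃) (one - half ε₁ ε₂ ε₃) = one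
      ∧ qmul (-1) (-1) (one - half ε₁ ε₂ ε₃) (half ε₁ ε₂ ε₃) = one
      ∧ qmul (-1) (-1) (half ε₁ ε₂ ε₃) (qmul (-1) (-1) (half ε₁ ε₂ ε₃) (half ε₁ ε₂ ε₃)) = -one
      ∧ qmul (-1) (-1) (half ε₁ ε₂ ε₃) (half ε₁ ε₂ ε₃) ≠ one
      ∧ half ε₁ ε₂ ε₃ ≠ one := by
  have mem : half ε₁ ε₂ ε₃ ∈ hurwitz := by
    obtain ⟨m₁, hm₁⟩ : ∃ m : ℤ, (ε₁ : ℚ) = 2 * m + 1 := by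
      rcases h₁ with rfl | rfl
      · exact ⟨0, by norm_num⟩
      · exact ⟨-1, by norm_num⟩
    obtain ⟨m₂, hm₂⟩ : ∃ m : ℤ, (ε₂ : ℚ) = 2 * m + 1 := by
      rcases h₂ with rfl | rfl
      · exact ⟨0, by norm_num⟩
      · exact ⟨-1, by norm_num⟩
    obtain ⟨m₃, hm₃⟩ : ∃ m : ℤ, (ε₃ : ℚ) = 2 * m + 1 := by
      rcases h₃ with rfl | rfl
      · exact ⟨0, by norm_num⟩
      · exact ⟨-1, by norm_num⟩
    rw [hm₁, hm₂, hm₃]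
    exact half_mem_hurwitz m₁ m₂ m₃
  have ne1 : half ε₁ ε₂ ε₃ ≠ one := by
    intro h; have := congrFun h 0; simp at this
  refine ⟨mem, ?_, ?_, ?_, ?_, ?_, ne1⟩
  · rcases h₁ with rfl | rfl <;> rcases h₂ with rfl | rfl <;> rcases h₃ with rfl | rfl <;> (simp [nrd]; norm_num)
  · rcases h₁ with rfl | rfl <;> rcases h₂ with rfl | rfl <;> rcases h₃ with rfl | rfl <;>
      (ext t; fin_cases t <;> simp <;> norm_num)
  · rcases h₁ with rfl | rfl <;> rcases h₂ with rfl | rfl <;> rcases h₃ with rfl | rfl <;>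
      (ext t; fin_cases t <;> simp <;> norm_num)
  · rcases h₁ with rfl | rfl <;> rcases h₂ with rfl | rfl <;> rcases h₃ with rfl | rfl <;>
      (ext t; fin_cases t <;> simp <;> norm_num)
  · intro h
    have := congrFun h 1
    rcases h₁ with rfl | rfl <;> rcases h₂ with rfl | rfl <;> rcases h₃ with rfl | rfl <;> simp at this <;> norm_num at this
/-- **(L1) for every tower, assembled**: for every odd triple `x_t = 2n_t + 1` there are signs `ε_t` such that the order-6 unit
`u = (1 + Σ ε_t e_t)/2` and its inverse lie in `T_{a,1}`; together with `±1` and `±u² = ±(u - 1)` (`tower_sq_mem`), six units. -/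
theorem levelOne_six_units (n₁ n₂ n₃ : ℤ) :
    ∃ ε₁ ε₂ ε₃ : ℤ, (ε₁ = 1 ∨ ε₁ = -1) ∧ (ε₂ = 1 ∨ ε₂ = -1) ∧ (ε₃ = 1 ∨ ε₃ = -1)
      ∧ half ε₁ ε₂ ε₃ ∈ tower hurwitz (half (2 * n₁ + 1) (2 * n₂ + 1) (2 * n₃ + 1)) 2
      ∧ one - half ε₁ ε₂ ε₃ ∈ tower hurwitz (half (2 * n₁ + 1) (2 * n₂ + 1) (2 * n₃ + 1)) 2
      ∧ qmul (-1) (-1) (half ε₁ ε₂ ε₃) (one - half ε₁ ε₂ ε₃) = one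
      ∧ qmul (-1) (-1) (half ε₁ ε₂ ε₃) (qmul (-1) (-1) (half ε₁ ε₂ ε₃) (half ε₁ ε₂ ε₃)) = -one
      ∧ half ε₁ ε₂ ε₃ ≠ one ∧ qmul (-1) (-1) (half ε₁ ε₂ ε₃) (half ε₁ ε₂ ε₃) ≠ one := by
  obtain ⟨ε₁, d₁, s₁, h₁⟩ := sign_mod_four n₁
  obtain ⟨ε₂, d₂, s₂, h₂⟩ := sign_mod_four n₂
  obtain ⟨ε₃, d₃, s₃, h₃⟩ := sign_mod_four n₃
  obtain ⟨hm, hm'⟩ := levelOne_unit_mem_tower n₁ n₂ n₃ ε₁ ε₂ ε₃ d₁ d₂ d₃ h₁ h₂ h₃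
  obtain ⟨_, _, hinv, _, hcube, hsq, hne⟩ := levelOne_unit_hexagon ε₁ ε₂ ε₃ s₁ s₂ s₃
  exact ⟨ε₁, ε₂, ε₃, s₁, s₂, s₃, hm, hm', hinv, hcube, hne, hsq⟩

/-! ## (U2) assembled for the towers of DI-gen(2) -/

/-- **(U2) FOR EVERY TOWER AND EVERY LEVEL `m ≥ 1`** (the hypotheses of the counting argument, all in one statement): let
`ω = ω_a = (1 + s_a)/2` for an odd triple and `u ∈ T_{a,m} = ℤ + ℤω + 2^m O` with `nrd u = 1`.  Then
(i) `u ≡ 1`, `u ≡ ω` or `u ≡ 1 + ω (mod 2O)`; (ii) in the first case `u = ±1`; (iii) `u² ∈ T_{a,m}`;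
(iv) if `u ≡ ω` then `u² ≡ 1 + ω`, and if `u ≡ 1 + ω` then `u² ≡ ω`.  With `unit_eq_or_eq_neg_of_sub_eq_two_smul` (two units in
one class are `±` each other) this is `|U_{a,m}| ∈ {2, 6}`; with `levelOne_six_units`, `|U_{a,1}| = 6`. -/
theorem unit_law_U2 (n₁ n₂ n₃ : ℤ) {m : ℕ} (hm : 1 ≤ m) {u : Q4}
    (hu : u ∈ tower hurwitz (half (2 * n₁ + 1) (2 * n₂ + 1) (2 * n₃ + 1)) ((2 : ℤ) ^ m))
    (hn : nrd (-1) (-1) u = 1) :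
    let ω := half (2 * n₁ + 1) (2 * n₂ + 1) (2 * n₃ + 1)
    (∃ β ∈ hurwitz, u - one = (2 : ℚ) • β ∨ u - ω = (2 : ℚ) • β ∨ u - (one + ω) = (2 : ℚ) • β)
    ∧ (∀ β ∈ hurwitz, u - one = (2 : ℚ) • β → u = one ∨ u = -one)
    ∧ qmul (-1) (-1) u u ∈ tower hurwitz ω ((2 : ℤ) ^ m)
    ∧ (∀ β ∈ hurwitz, u - ω = (2 : ℚ) • β → ∃ γ ∈ hurwitz, qmul (-1) (-1) u u - (one + ω) = (2 : ℚ) • γ)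
    ∧ (∀ β ∈ hurwitz, u - (one + ω) = (2 : ℚ) • β → ∃ γ ∈ hurwitz, qmul (-1) (-1) u u - ω = (2 : ℚ) • γ) := by
  intro ω
  have hωO : ω ∈ hurwitz := half_mem_hurwitz n₁ n₂ n₃
  have huO : u ∈ hurwitz := tower_subset hurwitz_add hurwitz_zsmul one_mem_hurwitz hωO _ hu
  obtain ⟨k, hk⟩ := N_odd n₁ n₂ n₃
  have hωsq := omega_sq n₁ n₂ n₃
  have hωt := (omega_nrd_trd n₁ n₂ n₃).2
  refine ⟨?_, ?_, ?_, ?_, ?_⟩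
  · obtain ⟨pb, qb, β, hp, hq, hβ, h⟩ := tower_residue_classes hωO hm hu
    have hneq : u ≠ (2 : ℚ) • β := norm_one_not_in_zero_class hβ hn
    rcases hp with rfl | rfl <;> rcases hq with rfl | rfl
    · exfalso; apply hneq; simpa using h
    · exact ⟨β, hβ, Or.inr (Or.inl (by simpa using h))⟩
    · exact ⟨β, hβ, Or.inl (by simpa using h)⟩
    · exact ⟨β, hβ, Or.inr (Or.inr (by simpa using h))⟩
  · intro β hβ h
    obtain ⟨kβ, hkβ⟩ := hurwitz_nrd β hβ
    exact eq_or_eq_neg_of_sub_eq_two_smul (by norm_num) (by norm_num) hn (nrd_one _ _) hkβ h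
  · obtain ⟨t, ht⟩ := hurwitz_trd u huO
    exact tower_sq_mem hurwitz_add hurwitz_zsmul zero_mem_hurwitz hu hn ht
  · intro β hβ h
    exact sq_class_of_gen_class hk hωsq hωt huO hβ hn h
  · intro β hβ h
    exact sq_class_of_one_add_gen_class hk hωsq hωt huO hβ hωO hn h

end Summit.HodgeConjecture.HodgeConjecture.HodgeLocus.Census.UnitRigidityTwo
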